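import Summits.Ventures.LatticeQCDFlow.Exactness.IMHAnyStartMSE
import Summits.Ventures.LatticeQCDFlow.Exactness.IMHAnyStartBurnIn
import Summits.Ventures.LatticeQCDFlow.Exactness.IMHColdStartPathMixture
import HarnessLib

/-!
# Two arbitrary starts of flow-MCMC agree to `r^b`: laws, statistics, window averages and mean-square errors of two
# runs of the same exact sampler from different initial laws — and the pair (cold, equilibrium) attains the bound

HONEST FRAMING: exact (Metropolis-corrected) sampling algorithms for lattice gauge theory;
figures of merit are autocorrelation/cost numbers at stated couplings and volumes; no
continuum-physics claim.

Venture `LatticeQCDFlow` (cell pub-lqcd), topic `Exactness`; FANOUT row 30 (lean-1, GEN-35).  NEW WORK of the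
cell, general state space.  `K = indepMH q w` (proposal `q`, normalised weight `w`, `π = w·q`, `w` maximal at `x₀`,
`r = 1 − 1/w(x₀)`).  GEN-34 compared every start with THE EQUILIBRIUM run (`Exactness/IMHAnyStart{Split,PathSplit,
BurnIn}`); in practice two runs are compared WITH EACH OTHER (two seeds' hot starts, a cold and a hot run, a run and
an independent replica).  Subtracting GEN-34's one-sided envelopes, which are the same interval for both starts:

* §1 one time: **`integral_iterate_bind_indepMH_twoStarts_abs_le`** — `|E_μ f(X_n) − E_ν f(X_n)| ≤ rⁿ·(b − a)` for
  `a ≤ f ≤ b` and ANY two initial laws `μ`, `ν`; **`iterate_bind_indepMH_real_twoStarts_abs_le`** —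
  `|μKⁿ(B) − νKⁿ(B)| ≤ rⁿ` for every measurable `B`.
* §2 the whole future after `b` discarded updates: **`imh_chain_shift_real_twoStarts_abs_le`** —
  `|P_μ(X_{b+·} ∈ E) − P_ν(X_{b+·} ∈ E)| ≤ r^b` for every measurable set of runs `E` (the Dobrushin coefficient of
  `θ_b` is at most `r^b`); **`imh_chain_shift_integral_twoStarts_abs_le`** — `|E_μ[F(X_{b+·})] − E_ν[F(X_{b+·})]| ≤
  r^b·(c − a)` for every measurable statistic `a ≤ F ≤ c`, and (**`…_of_log_le`**) `≤ ε·(c − a)` once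
  `log(1/ε) ≤ b/w(x₀)`.
* §3 **`imh_chain_shift_real_twoStarts_sharp`** — IT IS ATTAINED: for the pair (cold start `δ_{x₀}`, equilibrium
  start `π`) with an atom-free proposal at `x₀`, at `E = {X_0 = x₀}` the difference is EXACTLY `r^b` (GEN-33's
  path-space total variation): the two-start constant `r^b` cannot be improved.
* §4 window averages and their errors: **`imh_chain_windowAverage_twoStarts_abs_le`** —
  `|E_μ[A_{N,b}] − E_ν[A_{N,b}]| ≤ (c − a)·r^b·S_N/N ≤ (c − a)·r^b·min(1, w(x₀)/N)` (`S_N = Σ_{t<N} r^t`);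
  **`imh_chain_windowMSE_twoStarts_abs_le`** — `|MSE_μ(N; b) − MSE_ν(N; b)| ≤ r^b·D²`, `D = max(π f − a, c − π f)`
  (from `Exactness/IMHAnyStartMSE`).

Reading (gauge files `Scaling/AutoregressiveGauge…TwoStarts`): two exact gauge samplers with the same proposal, started
anywhere, cannot differ after `b` discarded configurations in ANY expected statistic by more than `(1 − A)^b ×` its
range, in any window average by more than `(c − a)(1 − A)^b·min(1, (1/A)/N)`, in mean-square error by more than
`(1 − A)^b·D²`; a cold and an equilibrium run differ by exactly `(1 − A)^b` on `{U_0 = cold}`.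
NOT CLAIMED: anything about the JOINT law of two runs (couplings, common random numbers); that two particular starts
differ at all; any number for a concrete weight.  No `sorry`, no new definitions, nothing cited as a fact.
-/

noncomputable section

namespace Summit.Ventures.LatticeQCDFlow.Exactness

open MeasureTheory ProbabilityTheory Function Finset
open scoped ENNReal
open Summit.Ventures.LatticeQCDFlow.Scoring

variable {Ω : Type*} [MeasurableSpace Ω] {q : Measure Ω} [IsProbabilityMeasure q] {w : Ω → ℝ}

/-! ## §1 One time, two starts -/

/-- **`|E_μ f(X_n) − E_ν f(X_n)| ≤ rⁿ·(b − a)`** for `a ≤ f ≤ b` measurable and ANY two initial laws. [ours] -/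
theorem integral_iterate_bind_indepMH_twoStarts_abs_le (hw : Measurable w) (hw0 : ∀ y, 0 < w y) {x₀ : Ω}
    (hmax : ∀ y, w y ≤ w x₀) [IsProbabilityMeasure (q.withDensity fun y => ENNReal.ofReal (w y))]
    (n : ℕ) (μ ν : Measure Ω) [IsProbabilityMeasure μ] [IsProbabilityMeasure ν] {f : Ω → ℝ} (hf : Measurable f)
    {a b : ℝ} (ha : ∀ x, a ≤ f x) (hb : ∀ x, f x ≤ b) :
    |∫ x, f x ∂((fun m : Measure Ω => m.bind (indepMH q w))^[n] μ) -
        ∫ x, f x ∂((fun m : Measure Ω => m.bind (indepMH q w))^[n] ν)| ≤ (1 - (w x₀)⁻¹) ^ n * (b - a) := by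
  obtain ⟨h1, h2⟩ := integral_iterate_bind_indepMH_mem_Icc (q := q) hw hw0 hmax n μ hf ha hb
  obtain ⟨h3, h4⟩ := integral_iterate_bind_indepMH_mem_Icc (q := q) hw hw0 hmax n ν hf ha hb
  rw [abs_le]
  constructor <;> nlinarith

/-- **`|μKⁿ(B) − νKⁿ(B)| ≤ rⁿ`** for every measurable `B` and any two initial laws. [ours] -/
theorem iterate_bind_indepMH_real_twoStarts_abs_le (hw : Measurable w) (hw0 : ∀ y, 0 < w y) {x₀ : Ω}
    (hmax : ∀ y, w y ≤ w x₀) [IsProbabilityMeasure (q.withDensity fun y => ENNReal.ofReal (w y))]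
    (n : ℕ) (μ ν : Measure Ω) [IsProbabilityMeasure μ] [IsProbabilityMeasure ν] {B : Set Ω} (hB : MeasurableSet B) :
    |((fun m : Measure Ω => m.bind (indepMH q w))^[n] μ).real B -
        ((fun m : Measure Ω => m.bind (indepMH q w))^[n] ν).real B| ≤ (1 - (w x₀)⁻¹) ^ n := by
  obtain ⟨h1, h2⟩ := iterate_bind_indepMH_real_sub_mem_Icc (q := q) hw hw0 hmax n μ hB
  obtain ⟨h3, h4⟩ := iterate_bind_indepMH_real_sub_mem_Icc (q := q) hw hw0 hmax n ν hB
  have hπ0 : 0 ≤ (q.withDensity fun y => ENNReal.ofReal (w y)).real B := measureReal_nonneg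
  have hπ1 : (q.withDensity fun y => ENNReal.ofReal (w y)).real B ≤ 1 := measureReal_le_one
  have hW : 1 ≤ w x₀ := one_le_of_mode (q := q) hmax
  have hr0 : 0 ≤ (1 - (w x₀)⁻¹) ^ n := pow_nonneg (sub_nonneg.2 (inv_le_one_of_one_le₀ hW)) n
  rw [abs_le]
  constructor <;> nlinarith

/-! ## §2 The whole future after `b` discarded updates, two starts -/

/-- **`|P_μ(X_{b+·} ∈ E) − P_ν(X_{b+·} ∈ E)| ≤ r^b`** for every measurable set of runs `E` and any two initial laws
(`w` a measurable `Fact`, positive, normalised, maximal at `x₀`). [ours] -/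
theorem imh_chain_shift_real_twoStarts_abs_le [Fact (Measurable w)] (hw0 : ∀ y, 0 < w y) {x₀ : Ω}
    (hmax : ∀ y, w y ≤ w x₀) [IsProbabilityMeasure (q.withDensity fun y => ENNReal.ofReal (w y))]
    (μ ν : Measure Ω) [IsProbabilityMeasure μ] [IsProbabilityMeasure ν] {E : Set (ℕ → Ω)} (hE : MeasurableSet E)
    (b : ℕ) :
    |(Kernel.trajMeasure (X := fun _ : ℕ => Ω) μ
          (fun n : ℕ => (indepMH q w).comap (fun h : (i : ↥(Finset.Iic n)) → Ω => h ⟨n, Finset.mem_Iic.2 le_rfl⟩)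
            (measurable_pi_apply _))).real ((fun (x : ℕ → Ω) (n : ℕ) => x (b + n)) ⁻¹' E) -
      (Kernel.trajMeasure (X := fun _ : ℕ => Ω) ν
          (fun n : ℕ => (indepMH q w).comap (fun h : (i : ↥(Finset.Iic n)) → Ω => h ⟨n, Finset.mem_Iic.2 le_rfl⟩)
            (measurable_pi_apply _))).real ((fun (x : ℕ → Ω) (n : ℕ) => x (b + n)) ⁻¹' E)| ≤
      (1 - (w x₀)⁻¹) ^ b := by
  have h1 := imh_chain_shift_real_anyStart_ge (q := q) hw0 hmax μ hE b
  have h2 := imh_chain_shift_real_anyStart_le (q := q) hw0 hmax μ hE b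
  have h3 := imh_chain_shift_real_anyStart_ge (q := q) hw0 hmax ν hE b
  have h4 := imh_chain_shift_real_anyStart_le (q := q) hw0 hmax ν hE b
  set pπ := (Kernel.trajMeasure (X := fun _ : ℕ => Ω) (q.withDensity fun y => ENNReal.ofReal (w y))
    (fun n : ℕ => (indepMH q w).comap (fun h : (i : ↥(Finset.Iic n)) → Ω => h ⟨n, Finset.mem_Iic.2 le_rfl⟩)
      (measurable_pi_apply _))).real E
  have hπ0 : 0 ≤ pπ := measureReal_nonneg
  have hπ1 : pπ ≤ 1 := measureReal_le_one
  have hW : 1 ≤ w x₀ := one_le_of_mode (q := q) hmax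
  have hr0 : 0 ≤ (1 - (w x₀)⁻¹) ^ b := pow_nonneg (sub_nonneg.2 (inv_le_one_of_one_le₀ hW)) b
  rw [abs_le]
  constructor <;> nlinarith

/-- **`|E_μ[F(X_{b+·})] − E_ν[F(X_{b+·})]| ≤ r^b·(c − a)`** for every measurable statistic `a ≤ F ≤ c` and any two
initial laws. [ours] -/
theorem imh_chain_shift_integral_twoStarts_abs_le [Fact (Measurable w)] (hw0 : ∀ y, 0 < w y) {x₀ : Ω}
    (hmax : ∀ y, w y ≤ w x₀) [IsProbabilityMeasure (q.withDensity fun y => ENNReal.ofReal (w y))]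
    (μ ν : Measure Ω) [IsProbabilityMeasure μ] [IsProbabilityMeasure ν] {F : (ℕ → Ω) → ℝ} (hF : Measurable F)
    {a c : ℝ} (ha : ∀ x, a ≤ F x) (hc : ∀ x, F x ≤ c) (b : ℕ) :
    |∫ x, F (fun n => x (b + n)) ∂(Kernel.trajMeasure (X := fun _ : ℕ => Ω) μ
        (fun n : ℕ => (indepMH q w).comap (fun h : (i : ↥(Finset.Iic n)) → Ω => h ⟨n, Finset.mem_Iic.2 le_rfl⟩)
          (measurable_pi_apply _))) -
      ∫ x, F (fun n => x (b + n)) ∂(Kernel.trajMeasure (X := fun _ : ℕ => Ω) ν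
        (fun n : ℕ => (indepMH q w).comap (fun h : (i : ↥(Finset.Iic n)) → Ω => h ⟨n, Finset.mem_Iic.2 le_rfl⟩)
          (measurable_pi_apply _)))| ≤ (1 - (w x₀)⁻¹) ^ b * (c - a) := by
  obtain ⟨h1, h2⟩ := imh_chain_shift_integral_anyStart_mem_Icc (q := q) hw0 hmax μ hF ha hc b
  obtain ⟨h3, h4⟩ := imh_chain_shift_integral_anyStart_mem_Icc (q := q) hw0 hmax ν hF ha hc b
  rw [abs_le]
  constructor <;> nlinarith

/-- **The burn-in rule for two starts**: `log(1/ε) ≤ b/w(x₀)` discarded updates leave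
`|E_μ[F(X_{b+·})] − E_ν[F(X_{b+·})]| ≤ ε·(c − a)`. [ours] -/
theorem imh_chain_shift_integral_twoStarts_abs_le_of_log_le [Fact (Measurable w)] (hw0 : ∀ y, 0 < w y) {x₀ : Ω}
    (hmax : ∀ y, w y ≤ w x₀) [IsProbabilityMeasure (q.withDensity fun y => ENNReal.ofReal (w y))]
    (μ ν : Measure Ω) [IsProbabilityMeasure μ] [IsProbabilityMeasure ν] {F : (ℕ → Ω) → ℝ} (hF : Measurable F)
    {a c : ℝ} (ha : ∀ x, a ≤ F x) (hc : ∀ x, F x ≤ c) {b : ℕ} {ε : ℝ} (hε : 0 < ε)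
    (hb : Real.log (1 / ε) ≤ b * (w x₀)⁻¹) :
    |∫ x, F (fun n => x (b + n)) ∂(Kernel.trajMeasure (X := fun _ : ℕ => Ω) μ
        (fun n : ℕ => (indepMH q w).comap (fun h : (i : ↥(Finset.Iic n)) → Ω => h ⟨n, Finset.mem_Iic.2 le_rfl⟩)
          (measurable_pi_apply _))) -
      ∫ x, F (fun n => x (b + n)) ∂(Kernel.trajMeasure (X := fun _ : ℕ => Ω) ν
        (fun n : ℕ => (indepMH q w).comap (fun h : (i : ↥(Finset.Iic n)) → Ω => h ⟨n, Finset.mem_Iic.2 le_rfl⟩)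
          (measurable_pi_apply _)))| ≤ ε * (c - a) := by
  refine (imh_chain_shift_integral_twoStarts_abs_le (q := q) hw0 hmax μ ν hF ha hc b).trans ?_
  have hca : 0 ≤ c - a := by
    have := (ha (fun _ => x₀)).trans (hc (fun _ => x₀))
    linarith
  exact mul_le_mul_of_nonneg_right (pow_mode_le_of_log_le (q := q) hmax hε hb) hca

/-! ## §3 The pair (cold start, equilibrium start) attains the bound -/

section Sharp

variable [MeasurableSingletonClass Ω]

/-- **THE TWO-START CONSTANT `r^b` IS ATTAINED**: with an atom-free proposal at the mode (`q{x₀} = 0`), the cold-started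
run and the equilibrium run differ after `b` discarded updates by EXACTLY `r^b` on the event `{X_0 = x₀}`. [ours,
bookkeeping on GEN-33's `imh_chain_shift_atMode_sub_stationary` and stationarity] -/
theorem imh_chain_shift_real_twoStarts_sharp [Fact (Measurable w)] (hw0 : ∀ y, 0 < w y) {x₀ : Ω}
    (hmax : ∀ y, w y ≤ w x₀) (hqx : q {x₀} = 0)
    [IsProbabilityMeasure (q.withDensity fun y => ENNReal.ofReal (w y))] (b : ℕ) :
    (Kernel.trajMeasure (X := fun _ : ℕ => Ω) (Measure.dirac x₀)
          (fun n : ℕ => (indepMH q w).comap (fun h : (i : ↥(Finset.Iic n)) → Ω => h ⟨n, Finset.mem_Iic.2 le_rfl⟩)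
            (measurable_pi_apply _))).real
        ((fun (x : ℕ → Ω) (n : ℕ) => x (b + n)) ⁻¹' {x : ℕ → Ω | x 0 ∈ ({x₀} : Set Ω)}) -
      (Kernel.trajMeasure (X := fun _ : ℕ => Ω) (q.withDensity fun y => ENNReal.ofReal (w y))
          (fun n : ℕ => (indepMH q w).comap (fun h : (i : ↥(Finset.Iic n)) → Ω => h ⟨n, Finset.mem_Iic.2 le_rfl⟩)
            (measurable_pi_apply _))).real
        ((fun (x : ℕ → Ω) (n : ℕ) => x (b + n)) ⁻¹' {x : ℕ → Ω | x 0 ∈ ({x₀} : Set Ω)}) =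
      (1 - (w x₀)⁻¹) ^ b := by
  have hE : MeasurableSet {x : ℕ → Ω | x 0 ∈ ({x₀} : Set Ω)} :=
    measurable_pi_apply 0 (measurableSet_singleton x₀)
  have hΘ : Measurable (fun (x : ℕ → Ω) (n : ℕ) => x (b + n)) :=
    measurable_pi_lambda _ fun n => measurable_pi_apply _
  -- stationarity: the equilibrium run is shift invariant
  have hstat : (Kernel.trajMeasure (X := fun _ : ℕ => Ω) (q.withDensity fun y => ENNReal.ofReal (w y))
      (fun n : ℕ => (indepMH q w).comap (fun h : (i : ↥(Finset.Iic n)) → Ω => h ⟨n, Finset.mem_Iic.2 le_rfl⟩)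
        (measurable_pi_apply _))).real ((fun (x : ℕ → Ω) (n : ℕ) => x (b + n)) ⁻¹' {x : ℕ → Ω | x 0 ∈ ({x₀} : Set Ω)}) =
      (Kernel.trajMeasure (X := fun _ : ℕ => Ω) (q.withDensity fun y => ENNReal.ofReal (w y))
        (fun n : ℕ => (indepMH q w).comap (fun h : (i : ↥(Finset.Iic n)) → Ω => h ⟨n, Finset.mem_Iic.2 le_rfl⟩)
          (measurable_pi_apply _))).real {x : ℕ → Ω | x 0 ∈ ({x₀} : Set Ω)} := by
    rw [measureReal_def, measureReal_def, ← Measure.map_apply hΘ hE, imh_chain_stationary_shift hw0 b]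
  rw [hstat]
  exact imh_chain_shift_atMode_sub_stationary hw0 hmax hqx b

end Sharp

/-! ## §4 Window averages and their mean-square errors, two starts -/

/-- **`|E_μ[A_{N,b}] − E_ν[A_{N,b}]| ≤ (c − a)·r^b·S_N/N`** and **`≤ (c − a)·r^b·min(1, w(x₀)/N)`** for the window
average of `a ≤ f ≤ c` over `[b, b+N)`, `N ≥ 1`, any two initial laws. [ours] -/
theorem imh_chain_windowAverage_twoStarts_abs_le [Fact (Measurable w)] (hw0 : ∀ y, 0 < w y) {x₀ : Ω}
    (hmax : ∀ y, w y ≤ w x₀) [IsProbabilityMeasure (q.withDensity fun y => ENNReal.ofReal (w y))]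
    (μ ν : Measure Ω) [IsProbabilityMeasure μ] [IsProbabilityMeasure ν] {f : Ω → ℝ} (hf : Measurable f) {a c : ℝ}
    (ha : ∀ x, a ≤ f x) (hc : ∀ x, f x ≤ c) (b : ℕ) {N : ℕ} (hN : N ≠ 0) :
    |∫ x, (∑ i ∈ range N, f (x (b + i))) / N ∂(Kernel.trajMeasure (X := fun _ : ℕ => Ω) μ
        (fun n : ℕ => (indepMH q w).comap (fun h : (i : ↥(Finset.Iic n)) → Ω => h ⟨n, Finset.mem_Iic.2 le_rfl⟩)
          (measurable_pi_apply _))) -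
      ∫ x, (∑ i ∈ range N, f (x (b + i))) / N ∂(Kernel.trajMeasure (X := fun _ : ℕ => Ω) ν
        (fun n : ℕ => (indepMH q w).comap (fun h : (i : ↥(Finset.Iic n)) → Ω => h ⟨n, Finset.mem_Iic.2 le_rfl⟩)
          (measurable_pi_apply _)))| ≤
      (c - a) * ((1 - (w x₀)⁻¹) ^ b * ∑ t ∈ range N, (1 - (w x₀)⁻¹) ^ t) / N ∧
    (c - a) * ((1 - (w x₀)⁻¹) ^ b * ∑ t ∈ range N, (1 - (w x₀)⁻¹) ^ t) / N ≤
      (c - a) * ((1 - (w x₀)⁻¹) ^ b * min 1 (w x₀ / N)) := by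
  obtain ⟨h1, h2⟩ := imh_chain_windowAverage_bias_anyStart_mem_Icc (q := q) hw0 hmax μ hf ha hc b hN
  obtain ⟨h3, h4⟩ := imh_chain_windowAverage_bias_anyStart_mem_Icc (q := q) hw0 hmax ν hf ha hc b hN
  have hNpos : (0 : ℝ) < N := by exact_mod_cast Nat.pos_of_ne_zero hN
  have hW : 1 ≤ w x₀ := one_le_of_mode (q := q) hmax
  have hr0 : 0 ≤ (1 - (w x₀)⁻¹) ^ b := pow_nonneg (sub_nonneg.2 (inv_le_one_of_one_le₀ hW)) b
  have hca : 0 ≤ c - a := by linarith [ha x₀, hc x₀]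
  have hS0 : 0 ≤ ∑ t ∈ range N, (1 - (w x₀)⁻¹) ^ t :=
    Finset.sum_nonneg fun t _ => pow_nonneg (sub_nonneg.2 (inv_le_one_of_one_le₀ hW)) t
  set m := ∫ z, f z ∂(q.withDensity fun y => ENNReal.ofReal (w y)) with hm
  have key : (a - m) * ((1 - (w x₀)⁻¹) ^ b * ∑ t ∈ range N, (1 - (w x₀)⁻¹) ^ t) / N -
      (c - m) * ((1 - (w x₀)⁻¹) ^ b * ∑ t ∈ range N, (1 - (w x₀)⁻¹) ^ t) / N =
      -((c - a) * ((1 - (w x₀)⁻¹) ^ b * ∑ t ∈ range N, (1 - (w x₀)⁻¹) ^ t) / N) := by ring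
  refine ⟨?_, ?_⟩
  · rw [abs_le]
    constructor <;> linarith
  · have hSN : (∑ t ∈ range N, (1 - (w x₀)⁻¹) ^ t) / N ≤ min 1 (w x₀ / N) := by
      refine le_min ?_ ?_
      · rw [div_le_one hNpos]; exact geom_sum_mode_le_card (q := q) hw0 hmax N
      · exact div_le_div_of_nonneg_right (geom_sum_mode_le_weight (q := q) hw0 hmax N) hNpos.le
    have := mul_le_mul_of_nonneg_left hSN (mul_nonneg hca hr0)
    calc (c - a) * ((1 - (w x₀)⁻¹) ^ b * ∑ t ∈ range N, (1 - (w x₀)⁻¹) ^ t) / N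
        = (c - a) * (1 - (w x₀)⁻¹) ^ b * ((∑ t ∈ range N, (1 - (w x₀)⁻¹) ^ t) / N) := by ring
      _ ≤ (c - a) * (1 - (w x₀)⁻¹) ^ b * min 1 (w x₀ / N) := this
      _ = _ := by ring

/-- **`|MSE_μ(N; b) − MSE_ν(N; b)| ≤ r^b·D²`**, `D = max(π f − a, c − π f)`: two runs from any two starts have
mean-square errors of their window averages within `r^b·D²` of each other (`N ≥ 1`). [ours] -/
theorem imh_chain_windowMSE_twoStarts_abs_le [Fact (Measurable w)] (hw0 : ∀ y, 0 < w y) {x₀ : Ω}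
    (hmax : ∀ y, w y ≤ w x₀) [IsProbabilityMeasure (q.withDensity fun y => ENNReal.ofReal (w y))]
    (μ ν : Measure Ω) [IsProbabilityMeasure μ] [IsProbabilityMeasure ν] {f : Ω → ℝ} (hf : Measurable f) {a c : ℝ}
    (ha : ∀ x, a ≤ f x) (hc : ∀ x, f x ≤ c) (b : ℕ) {N : ℕ} (hN : N ≠ 0) :
    |∫ x, ((∑ i ∈ range N, f (x (b + i))) / N - ∫ z, f z ∂(q.withDensity fun y => ENNReal.ofReal (w y))) ^ 2
        ∂(Kernel.trajMeasure (X := fun _ : ℕ => Ω) μ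
          (fun n : ℕ => (indepMH q w).comap (fun h : (i : ↥(Finset.Iic n)) → Ω => h ⟨n, Finset.mem_Iic.2 le_rfl⟩)
            (measurable_pi_apply _))) -
      ∫ x, ((∑ i ∈ range N, f (x (b + i))) / N - ∫ z, f z ∂(q.withDensity fun y => ENNReal.ofReal (w y))) ^ 2
        ∂(Kernel.trajMeasure (X := fun _ : ℕ => Ω) ν
          (fun n : ℕ => (indepMH q w).comap (fun h : (i : ↥(Finset.Iic n)) → Ω => h ⟨n, Finset.mem_Iic.2 le_rfl⟩)
            (measurable_pi_apply _)))| ≤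
      (1 - (w x₀)⁻¹) ^ b *
        (max (∫ z, f z ∂(q.withDensity fun y => ENNReal.ofReal (w y)) - a)
          (c - ∫ z, f z ∂(q.withDensity fun y => ENNReal.ofReal (w y)))) ^ 2 := by
  obtain ⟨h1, h2⟩ := imh_chain_windowMSE_anyStart_mem_Icc (q := q) hw0 hmax μ hf ha hc b hN
  obtain ⟨h3, h4⟩ := imh_chain_windowMSE_anyStart_mem_Icc (q := q) hw0 hmax ν hf ha hc b hN
  have hW : 1 ≤ w x₀ := one_le_of_mode (q := q) hmax
  have hr0 : 0 ≤ (1 - (w x₀)⁻¹) ^ b := pow_nonneg (sub_nonneg.2 (inv_le_one_of_one_le₀ hW)) b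
  have hM0 := imh_chain_windowMSE_anyStart_ge (q := q) hw0 hmax (q.withDensity fun y => ENNReal.ofReal (w y)) hf
    ha hc 0 hN
  simp only [pow_zero, sub_self, zero_mul, zero_add] at hM0
  have hMD := imh_chain_windowMSE_anyStart_le (q := q) hw0 hmax (q.withDensity fun y => ENNReal.ofReal (w y)) hf
    ha hc 0 hN
  simp only [pow_zero, sub_self, zero_mul, one_mul, zero_add] at hMD
  rw [abs_le]
  constructor <;> nlinarith

end Summit.Ventures.LatticeQCDFlow.Exactness
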